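import Summits.Ventures.CertifiedManyBodySolver.Certificates.HubbardSquare_n7o8_obsOP1E_TLB0gbD2_box1corners_face
import Literature.MathematicalPhysics.QuantumLattice.HubbardEnergyDensityChordBounds
import Literature.MathematicalPhysics.QuantumLattice.HubbardFillingBoxEnergyBounds
import Summits.Ventures.CertifiedManyBodySolver.Certificates.HubbardSquare_n7o8_boxword_cuprate_3d_v0
import HarnessLib
import HarnessLib.Audit

/-!
# Ventures/CertifiedManyBodySolver — Certificates/HubbardSquare_n7o8_obsOP1E_TLB0gbD2_box1corners_box3d.lean

HONEST FRAMING: first certified bounds on pairing observables; positivity-scale pair-LRO CEILINGS (a ceiling never speaks to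
the PRESENCE of order; × ≈ 70 above print); not informative vs print; not a superconductivity verdict; no phase sentence.
CANDIDATE (hubbard-obs RULING (ii) d279, item «BOX1-OP1E-CORNERS»). Zero compute, no `sorry`, no new axiom; nothing is asserted
unconditionally. Cell hubbard-algo (D-0042 crew (5)), seat hubbard-box-eng-3 (`prover-hubbard-box-eng-3-g7-0`).

«BOX1-OP1E-CORNERS» — THE 3-D BOX EDITION AT ZERO EXTRA SOLVES. The four n = 7/8 corner rows of `…_box1corners_face.lean` are read at
EVERY density `n ∈ [173/200, 177/200]` of box #1 through the filling multipliers' Lagrangian sensitivity (the row's `Σ_σ μ_σ (N_σ/L² − 7/16)`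
term, exactly as `OP1ERowAt.ceilingAt_ray_density` of `…_box1chord_A0.lean`): (§1) the four-anchor MIXED ROW on its own
(`OP1ERowAtU.mix4_row`, the row behind `ceilingAt_mix4`) and its Koma–Tasaki reading at density `n` (`OP1ERowAtU.ceilingAt_density`,
hubbard-obs-p1's tower discharger at `n`); (§2) the generic 3-D theorem `box1Box3d_pairLROCeilingAt_of_cornerRows`: with the cap AT
DENSITY `n` taken as the tensor interpolant of four corner references `T_v` (hypothesis `hT`), the mixed constant is a weighted MEAN of the
per-corner transported constants `c_v + κ_v(u_v − T_v) + (Σ_σ μ_vσ)(n/2 − 7/16)`, so `|mean| ≤ m` ⇒ the leaf at `c′ ≥ m²`; (§3) the caps at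
density `n` BY NAME: below 7/8 the VACUUM CHORD of the box-#1 cap pyramid (`energyDensityTT'_le_vacuum_chord`: `e(n) ≤ (8n/7)·pyr`), above
7/8 the DENSITY CHORD to the `n = 1` cap `R₁max` of hubbard-box-eng-1's `BoxWordCuprate3d.boxCuprate3d_cap1_of` (#472, #488 BY NODE;
`energyDensityTT'_le_density_chord`), both composed with the pyramid's convexity (`box1CapPyramid_le_bilinear`); and the numeric theorem
`box1_op1e_corners_box3d`: for EVERY `(U, t′, n) ∈ [15/2, 17/2] × [−3/10, −1/5] × [173/200, 177/200]`, `ObsPairLROCeilingAt t′ U n c₃`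
with the constant printed there (the worst point is the NW corner at the LOW density face `n = 173/200`: the filling term costs
`Λ_v·(7/16 − n/2)` there and PAYS BACK above 7/8). Comparators: face editions 0.6830181 (FS-1 cap) / 0.7386301 (pure-node cap); CHORD 3-D
edition 0.8802759 (`box1chord_box3d`). WHAT THIS IS NOT: a registry row or MOVE (the pen's); a phase word; informative vs print.
References: Koma–Tasaki, J. Stat. Phys. 76 (1994) 745 [KomaTasaki1994]; Israel (1979) Thm I.3.4 [Israel1979]; Ruelle (1969) §3.3 [Ruelle1969]; Xu et al. (2024) [XuEtAl2024].
-/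

noncomputable section

namespace Summit.Ventures.CertifiedManyBodySolver.Certificates

open Matrix Complex Finset Literature.MathematicalPhysics.QuantumLattice Literature.Probability.LatticeModels
open Literature.MathematicalPhysics.QuantumLattice.HubbardWave0 ThermodynamicLimit Filter Topology
open Literature.MathematicalPhysics.QuantumManyBody.StateRelaxation
open Summit.Ventures.CertifiedManyBodySolver.Observables
open Summit.Ventures.CertifiedManyBodySolver.Transport
open scoped ComplexOrder ComplexConjugate BigOperators
open Set

/-! ### §1 The mixed row on its own, and the reading of a row at any density -/

/-- **The FOUR-ANCHOR MIXED ROW at `θ = (tp, U)`** (the row behind `OP1ERowAtU.ceilingAt_mix4`, stated on its own so that it can be read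
at ANY density): rows at `θ_v`, weights `w_v ≥ 0` with `Σ w_v = W > 0`, `Σ w_v κ_v = 1` and both `κ`-weighted pencil moments cancelled give the
row `OP1ERowAtU tp U ((Σ_v w_v(c_v + κ_v u_v) − T)/W) (1/W) T ((Σ_v w_v μ_v)/W)` for every real reference `T`. Pure algebra
(`TTPrimeFree.re_expect_tt_affine`), every unit ζ. [cite: KomaTasaki1994, Theorem 5] [cite: XuEtAl2024, eq. (1)] -/
theorem OP1ERowAtU.mix4_row
    {tp₁ U₁ c₁ κ₁ u₁ tp₂ U₂ c₂ κ₂ u₂ tp₃ U₃ c₃ κ₃ u₃ tp₄ U₄ c₄ κ₄ u₄ : ℝ} {μ₁ μ₂ μ₃ μ₄ : Fin 2 → ℝ}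
    (h₁ : OP1ERowAtU tp₁ U₁ c₁ κ₁ u₁ μ₁) (h₂ : OP1ERowAtU tp₂ U₂ c₂ κ₂ u₂ μ₂)
    (h₃ : OP1ERowAtU tp₃ U₃ c₃ κ₃ u₃ μ₃) (h₄ : OP1ERowAtU tp₄ U₄ c₄ κ₄ u₄ μ₄)
    {tp U w₁ w₂ w₃ w₄ : ℝ} (hw₁ : 0 ≤ w₁) (hw₂ : 0 ≤ w₂) (hw₃ : 0 ≤ w₃) (hw₄ : 0 ≤ w₄)
    (hW : 0 < w₁ + w₂ + w₃ + w₄)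
    (hS : w₁ * κ₁ + w₂ * κ₂ + w₃ * κ₃ + w₄ * κ₄ = 1)
    (hK : w₁ * κ₁ * (tp - tp₁) + w₂ * κ₂ * (tp - tp₂) + w₃ * κ₃ * (tp - tp₃) + w₄ * κ₄ * (tp - tp₄) = 0)
    (hD : w₁ * κ₁ * (U₁ - U) + w₂ * κ₂ * (U₂ - U) + w₃ * κ₃ * (U₃ - U) + w₄ * κ₄ * (U₄ - U) = 0) (T : ℝ) :
    OP1ERowAtU tp U
      ((w₁ * (c₁ + κ₁ * u₁) + w₂ * (c₂ + κ₂ * u₂) + w₃ * (c₃ + κ₃ * u₃) + w₄ * (c₄ + κ₄ * u₄) - T) / (w₁ + w₂ + w₃ + w₄))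
      (1 / (w₁ + w₂ + w₃ + w₄)) T (fun σ => (w₁ * μ₁ σ + w₂ * μ₂ σ + w₃ * μ₃ σ + w₄ * μ₄ σ) / (w₁ + w₂ + w₃ + w₄)) := by
  set W := w₁ + w₂ + w₃ + w₄ with hWdef
  intro L _ hInj ζ hL hζ
  have r₁ := h₁ L hInj ζ hL hζ
  have r₂ := h₂ L hInj ζ hL hζ
  have r₃ := h₃ L hInj ζ hL hζ
  have r₄ := h₄ L hInj ζ hL hζ
  -- pencil identities: every anchor energy in terms of the energy AT θ plus the two pencil directions
  have e₁ := TTPrimeFree.re_expect_tt_affine (L := L) 1 tp U tp₁ U₁ ζ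
  have e₂ := TTPrimeFree.re_expect_tt_affine (L := L) 1 tp U tp₂ U₂ ζ
  have e₃ := TTPrimeFree.re_expect_tt_affine (L := L) 1 tp U tp₃ U₃ ζ
  have e₄ := TTPrimeFree.re_expect_tt_affine (L := L) 1 tp U tp₄ U₄ ζ
  simp only [Literature.MathematicalPhysics.QuantumLattice.expect] at e₁ e₂ e₃ e₄
  rw [e₁] at r₁; rw [e₂] at r₂; rw [e₃] at r₃; rw [e₄] at r₄
  -- abbreviations (all real numbers)
  set E := (star ζ ⬝ᵥ (hubbardTorusTT' L 1 tp U *ᵥ ζ)).re with hE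
  set Kd := (star ζ ⬝ᵥ (TTPrimeFree.diagHop L *ᵥ ζ)).re with hKd
  set Dd := (star ζ ⬝ᵥ ((∑ x : FermionTorus 2 L, numberOp x 0 * numberOp x 1) *ᵥ ζ)).re with hDd
  set R := (orbitState (spaceGroupUnitary op1eD2_TLB0gbD2) ζ (fermionEmbed (PolySite.toTorusEmb L hInj)
      (-(fermionEmbed (PolySite.incl pairRegion_subset_op1eWindow_TLB0gbD2)
        (localPairAt (insert (0 : Site 2) unitSteps) dWaveFormFactor 0))))).re with hR
  simp only [Fin.sum_univ_two] at r₁ r₂ r₃ r₄ ⊢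
  set N0 := (star ζ ⬝ᵥ ((∑ y : FermionTorus 2 L, numberOp y 0) *ᵥ ζ)).re with hN0
  set N1 := (star ζ ⬝ᵥ ((∑ y : FermionTorus 2 L, numberOp y 1) *ᵥ ζ)).re with hN1
  have hL2 : (0 : ℝ) < (L : ℝ) ^ 2 := by
    have : (3 : ℝ) ≤ (L : ℝ) := by exact_mod_cast hL
    positivity
  have hWne : W ≠ 0 := ne_of_gt hW
  -- weighted sum of the four rows ≤ W·R
  have s₁ := mul_le_mul_of_nonneg_left r₁ hw₁
  have s₂ := mul_le_mul_of_nonneg_left r₂ hw₂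
  have s₃ := mul_le_mul_of_nonneg_left r₃ hw₃
  have s₄ := mul_le_mul_of_nonneg_left r₄ hw₄
  -- W × (the mixed row's left-hand side)
  set LW := (w₁ * (c₁ + κ₁ * u₁) + w₂ * (c₂ + κ₂ * u₂) + w₃ * (c₃ + κ₃ * u₃) + w₄ * (c₄ + κ₄ * u₄) - T) +
      ((w₁ * μ₁ 0 + w₂ * μ₂ 0 + w₃ * μ₃ 0 + w₄ * μ₄ 0) * (N0 / (L : ℝ) ^ 2 - 7 / 16) +
       (w₁ * μ₁ 1 + w₂ * μ₂ 1 + w₃ * μ₃ 1 + w₄ * μ₄ 1) * (N1 / (L : ℝ) ^ 2 - 7 / 16)) +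
      (T - E / (L : ℝ) ^ 2) with hLW
  have hsum : LW =
      w₁ * (c₁ + (μ₁ 0 * (N0 / (L : ℝ) ^ 2 - 7 / 16) + μ₁ 1 * (N1 / (L : ℝ) ^ 2 - 7 / 16)) +
          κ₁ * (u₁ - (E + (tp - tp₁) * Kd + (U₁ - U) * Dd) / (L : ℝ) ^ 2)) +
      w₂ * (c₂ + (μ₂ 0 * (N0 / (L : ℝ) ^ 2 - 7 / 16) + μ₂ 1 * (N1 / (L : ℝ) ^ 2 - 7 / 16)) +
          κ₂ * (u₂ - (E + (tp - tp₂) * Kd + (U₂ - U) * Dd) / (L : ℝ) ^ 2)) +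
      w₃ * (c₃ + (μ₃ 0 * (N0 / (L : ℝ) ^ 2 - 7 / 16) + μ₃ 1 * (N1 / (L : ℝ) ^ 2 - 7 / 16)) +
          κ₃ * (u₃ - (E + (tp - tp₃) * Kd + (U₃ - U) * Dd) / (L : ℝ) ^ 2)) +
      w₄ * (c₄ + (μ₄ 0 * (N0 / (L : ℝ) ^ 2 - 7 / 16) + μ₄ 1 * (N1 / (L : ℝ) ^ 2 - 7 / 16)) +
          κ₄ * (u₄ - (E + (tp - tp₄) * Kd + (U₄ - U) * Dd) / (L : ℝ) ^ 2)) := by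
    rw [hLW]
    linear_combination (E / (L : ℝ) ^ 2) * hS + (Kd / (L : ℝ) ^ 2) * hK + (Dd / (L : ℝ) ^ 2) * hD
  have hLW_le : LW ≤ W * R := by
    rw [hsum, hWdef]
    linarith [s₁, s₂, s₃, s₄]
  have goal_eq : (w₁ * (c₁ + κ₁ * u₁) + w₂ * (c₂ + κ₂ * u₂) + w₃ * (c₃ + κ₃ * u₃) + w₄ * (c₄ + κ₄ * u₄) - T) / W +
      ((w₁ * μ₁ 0 + w₂ * μ₂ 0 + w₃ * μ₃ 0 + w₄ * μ₄ 0) / W * (N0 / (L : ℝ) ^ 2 - 7 / 16) +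
       (w₁ * μ₁ 1 + w₂ * μ₂ 1 + w₃ * μ₃ 1 + w₄ * μ₄ 1) / W * (N1 / (L : ℝ) ^ 2 - 7 / 16)) +
      1 / W * (T - E / (L : ℝ) ^ 2) = LW / W := by
    rw [hLW]
    field_simp
  rw [goal_eq, div_le_iff₀ hW]
  linarith [hLW_le]

/-- **Koma–Tasaki reading of ONE row at `(tp, U)` AT DENSITY `n`**: a row `OP1ERowAtU tp U c κ u μ` (filling reference `7/16`), `κ ≥ 0`,
`U ≥ 0`, `0 < n < 2` and a CAP `e(1,tp,U;n) ≤ T` give `ObsPairLROCeilingAt tp U n c′` for every rational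
`c′ ≥ (c − κ(T − u) + (Σ_σ μ_σ)(n/2 − 7/16))²` — the filling multipliers' Lagrangian sensitivity carries the row to density `n`
(hubbard-obs-p1's tower discharger at `n`, no auxiliary row). A ceiling; says nothing about presence. [cite: KomaTasaki1994, Theorem 5] -/
theorem OP1ERowAtU.ceilingAt_density {tp U c κ u : ℝ} {μ : Fin 2 → ℝ} (h : OP1ERowAtU tp U c κ u μ) (hκ : 0 ≤ κ) (hU : 0 ≤ U)
    {n T : ℝ} (hn0 : 0 < n) (hn2 : n < 2) (hT : energyDensityTT' 1 tp U n ≤ T)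
    {c' : ℚ} (hc' : (c - κ * (T - u) + (∑ σ : Fin 2, μ σ) * (n / 2 - 7 / 16)) ^ 2 ≤ ((c' : ℚ) : ℝ)) :
    ObsPairLROCeilingAt tp U n c' := by
  classical
  obtain ⟨L₀, hL₀⟩ := exists_forall_le_injOn_proj (d := 2) op1eWindow_TLB0gbD2
  have hInj : ∀ L : ℕ, max L₀ 3 ≤ L → Set.InjOn (Torus.proj (d := 2) L) ↑op1eWindow_TLB0gbD2 :=
    fun L hL => hL₀ L (le_trans (le_max_left _ _) hL)
  refine ObsPairLROCeilingAt_of_onePoint_orbitState_bound_sq_aux (c := c) (A := κ * (T - u))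
    (u := T) (ν := 7 / 16) hU hn0 hn2 μ hκ hT (ι := Fin 0)
    (fun _ => tp) (fun _ => U) (fun _ => 1) (fun _ => 0) (fun _ => 0)
    (fun _ => hU) (fun _ => one_pos) (fun _ => le_rfl) (fun _ => by simp)
    op1eD2_TLB0gbD2_nonempty b1gSign_eq_one_of_mem_op1eD2_TLB0gbD2 pairRegion_subset_op1eWindow_TLB0gbD2
    (max L₀ 3) hInj ?_ hc'
  intro L _ hL ζ hζ
  have h3 : 3 ≤ L := le_trans (le_max_right _ _) hL
  have r := h L (hInj L hL) ζ h3 hζ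
  simp only [Finset.univ_eq_empty, Finset.sum_empty, add_zero]
  convert r using 1
  ring

/-! ### §2 The 3-D box theorem (generic literals; the cap at density `n` as a hypothesis) -/

/-- **THE 3-D BOX THEOREM (generic literals).** Four OP1-E rows at the outer corners of the n = 7/8 face of box #1 (`0 < κ_v ≤ Kκ`),
a point `(tp, U)` of the face, a density `0 < n < 2`, four corner references AT DENSITY `n`, `T_v`, whose tensor interpolant caps
`e(1,tp,U;n)` (hypothesis `hT`; discharged in §3 by the vacuum / density chords of the cap pyramid), and a bound `m` on the per-corner
transported constants `|c_v + κ_v(u_v − T_v) + (μ_v0 + μ_v1)(n/2 − 7/16)| ≤ m` give `ObsPairLROCeilingAt tp U n c′` for every rational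
`c′ ≥ m²`: the four-anchor mixed row (tensor weights / κ_v) read at density `n`, whose constant is a weighted MEAN of the per-corner
constants. No transport, no drift cost, no new solve. A ceiling; says nothing about presence. [cite: KomaTasaki1994, Theorem 5] [cite: Israel1979, Thm. I.3.4] -/
theorem box1Box3d_pairLROCeilingAt_of_cornerRows
    {c₁ κ₁ u₁ c₂ κ₂ u₂ c₃ κ₃ u₃ c₄ κ₄ u₄ Kκ m : ℝ} {μ₁ μ₂ μ₃ μ₄ : Fin 2 → ℝ}
    (hSW : OP1ERowAtU (-3/10) (15/2) c₁ κ₁ u₁ μ₁) (hNW : OP1ERowAtU (-1/5) (15/2) c₂ κ₂ u₂ μ₂)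
    (hSE : OP1ERowAtU (-3/10) (17/2) c₃ κ₃ u₃ μ₃) (hNE : OP1ERowAtU (-1/5) (17/2) c₄ κ₄ u₄ μ₄)
    (hκ₁ : 0 < κ₁) (hκ₂ : 0 < κ₂) (hκ₃ : 0 < κ₃) (hκ₄ : 0 < κ₄)
    (hK₁ : κ₁ ≤ Kκ) (hK₂ : κ₂ ≤ Kκ) (hK₃ : κ₃ ≤ Kκ) (hK₄ : κ₄ ≤ Kκ)
    {tp U n T₁ T₂ T₃ T₄ : ℝ} (htp : -3/10 ≤ tp ∧ tp ≤ -1/5) (hU : 15/2 ≤ U ∧ U ≤ 17/2) (hn0 : 0 < n) (hn2 : n < 2)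
    (hT : energyDensityTT' 1 tp U n ≤
      10 * ((17/2 - U) * (-1/5 - tp)) * T₁ + 10 * ((17/2 - U) * (tp + 3/10)) * T₂ +
      10 * ((U - 15/2) * (-1/5 - tp)) * T₃ + 10 * ((U - 15/2) * (tp + 3/10)) * T₄)
    (hg₁ : -m ≤ c₁ + κ₁ * (u₁ - T₁) + (μ₁ 0 + μ₁ 1) * (n / 2 - 7 / 16) ∧ c₁ + κ₁ * (u₁ - T₁) + (μ₁ 0 + μ₁ 1) * (n / 2 - 7 / 16) ≤ m)
    (hg₂ : -m ≤ c₂ + κ₂ * (u₂ - T₂) + (μ₂ 0 + μ₂ 1) * (n / 2 - 7 / 16) ∧ c₂ + κ₂ * (u₂ - T₂) + (μ₂ 0 + μ₂ 1) * (n / 2 - 7 / 16) ≤ m)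
    (hg₃ : -m ≤ c₃ + κ₃ * (u₃ - T₃) + (μ₃ 0 + μ₃ 1) * (n / 2 - 7 / 16) ∧ c₃ + κ₃ * (u₃ - T₃) + (μ₃ 0 + μ₃ 1) * (n / 2 - 7 / 16) ≤ m)
    (hg₄ : -m ≤ c₄ + κ₄ * (u₄ - T₄) + (μ₄ 0 + μ₄ 1) * (n / 2 - 7 / 16) ∧ c₄ + κ₄ * (u₄ - T₄) + (μ₄ 0 + μ₄ 1) * (n / 2 - 7 / 16) ≤ m)
    {c' : ℚ} (hc' : m ^ 2 ≤ ((c' : ℚ) : ℝ)) :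
    ObsPairLROCeilingAt tp U n c' := by
  obtain ⟨ht1, ht2⟩ := htp
  obtain ⟨hU1, hU2⟩ := hU
  have hKpos : 0 < Kκ := lt_of_lt_of_le hκ₁ hK₁
  have hU0 : (0:ℝ) ≤ U := by linarith
  set a₁ := 10 * ((17/2 - U) * (-1/5 - tp)) with ha₁
  set a₂ := 10 * ((17/2 - U) * (tp + 3/10)) with ha₂
  set a₃ := 10 * ((U - 15/2) * (-1/5 - tp)) with ha₃
  set a₄ := 10 * ((U - 15/2) * (tp + 3/10)) with ha₄
  have ha₁0 : 0 ≤ a₁ := by rw [ha₁]; exact mul_nonneg (by norm_num) (mul_nonneg (by linarith) (by linarith))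
  have ha₂0 : 0 ≤ a₂ := by rw [ha₂]; exact mul_nonneg (by norm_num) (mul_nonneg (by linarith) (by linarith))
  have ha₃0 : 0 ≤ a₃ := by rw [ha₃]; exact mul_nonneg (by norm_num) (mul_nonneg (by linarith) (by linarith))
  have ha₄0 : 0 ≤ a₄ := by rw [ha₄]; exact mul_nonneg (by norm_num) (mul_nonneg (by linarith) (by linarith))
  have hsum1 : a₁ + a₂ + a₃ + a₄ = 1 := by rw [ha₁, ha₂, ha₃, ha₄]; ring
  have hw₁ : 0 ≤ a₁ / κ₁ := div_nonneg ha₁0 hκ₁.le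
  have hw₂ : 0 ≤ a₂ / κ₂ := div_nonneg ha₂0 hκ₂.le
  have hw₃ : 0 ≤ a₃ / κ₃ := div_nonneg ha₃0 hκ₃.le
  have hw₄ : 0 ≤ a₄ / κ₄ := div_nonneg ha₄0 hκ₄.le
  have hW : 0 < a₁ / κ₁ + a₂ / κ₂ + a₃ / κ₃ + a₄ / κ₄ := by
    have l₁ : a₁ / Kκ ≤ a₁ / κ₁ := div_le_div_of_nonneg_left ha₁0 hκ₁ hK₁
    have l₂ : a₂ / Kκ ≤ a₂ / κ₂ := div_le_div_of_nonneg_left ha₂0 hκ₂ hK₂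
    have l₃ : a₃ / Kκ ≤ a₃ / κ₃ := div_le_div_of_nonneg_left ha₃0 hκ₃ hK₃
    have l₄ : a₄ / Kκ ≤ a₄ / κ₄ := div_le_div_of_nonneg_left ha₄0 hκ₄ hK₄
    have e : a₁ / Kκ + a₂ / Kκ + a₃ / Kκ + a₄ / Kκ = 1 / Kκ := by
      rw [← add_div, ← add_div, ← add_div, hsum1]
    have hk : (0:ℝ) < 1 / Kκ := by positivity
    linarith
  have hS : a₁ / κ₁ * κ₁ + a₂ / κ₂ * κ₂ + a₃ / κ₃ * κ₃ + a₄ / κ₄ * κ₄ = 1 := by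
    rw [div_mul_cancel₀ _ hκ₁.ne', div_mul_cancel₀ _ hκ₂.ne', div_mul_cancel₀ _ hκ₃.ne', div_mul_cancel₀ _ hκ₄.ne']
    exact hsum1
  have hKc : a₁ / κ₁ * κ₁ * (tp - (-3/10)) + a₂ / κ₂ * κ₂ * (tp - (-1/5)) + a₃ / κ₃ * κ₃ * (tp - (-3/10)) +
      a₄ / κ₄ * κ₄ * (tp - (-1/5)) = 0 := by
    rw [div_mul_cancel₀ _ hκ₁.ne', div_mul_cancel₀ _ hκ₂.ne', div_mul_cancel₀ _ hκ₃.ne', div_mul_cancel₀ _ hκ₄.ne',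
      ha₁, ha₂, ha₃, ha₄]
    ring
  have hD : a₁ / κ₁ * κ₁ * (15/2 - U) + a₂ / κ₂ * κ₂ * (15/2 - U) + a₃ / κ₃ * κ₃ * (17/2 - U) +
      a₄ / κ₄ * κ₄ * (17/2 - U) = 0 := by
    rw [div_mul_cancel₀ _ hκ₁.ne', div_mul_cancel₀ _ hκ₂.ne', div_mul_cancel₀ _ hκ₃.ne', div_mul_cancel₀ _ hκ₄.ne',
      ha₁, ha₂, ha₃, ha₄]
    ring
  -- the mixed row at (tp, U) with reference T := the tensor interpolant of the T_v, read at density n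
  have hrow := OP1ERowAtU.mix4_row hSW hNW hSE hNE hw₁ hw₂ hw₃ hw₄ hW hS hKc hD (a₁ * T₁ + a₂ * T₂ + a₃ * T₃ + a₄ * T₄)
  have hκ : (0 : ℝ) ≤ 1 / (a₁ / κ₁ + a₂ / κ₂ + a₃ / κ₃ + a₄ / κ₄) := by positivity
  refine OP1ERowAtU.ceilingAt_density hrow hκ hU0 hn0 hn2 hT ?_
  -- the constant: κ(T − T) = 0 and the rest is (Σ_v (a_v/κ_v)·g_v)/W, a weighted mean of the transported corner constants g_v
  set W := a₁ / κ₁ + a₂ / κ₂ + a₃ / κ₃ + a₄ / κ₄ with hWdef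
  set g₁ := c₁ + κ₁ * (u₁ - T₁) + (μ₁ 0 + μ₁ 1) * (n / 2 - 7 / 16) with hg₁def
  set g₂ := c₂ + κ₂ * (u₂ - T₂) + (μ₂ 0 + μ₂ 1) * (n / 2 - 7 / 16) with hg₂def
  set g₃ := c₃ + κ₃ * (u₃ - T₃) + (μ₃ 0 + μ₃ 1) * (n / 2 - 7 / 16) with hg₃def
  set g₄ := c₄ + κ₄ * (u₄ - T₄) + (μ₄ 0 + μ₄ 1) * (n / 2 - 7 / 16) with hg₄def
  set S := a₁ / κ₁ * g₁ + a₂ / κ₂ * g₂ + a₃ / κ₃ * g₃ + a₄ / κ₄ * g₄ with hSdef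
  have key : (a₁ / κ₁ * (c₁ + κ₁ * u₁) + a₂ / κ₂ * (c₂ + κ₂ * u₂) + a₃ / κ₃ * (c₃ + κ₃ * u₃) + a₄ / κ₄ * (c₄ + κ₄ * u₄) -
        (a₁ * T₁ + a₂ * T₂ + a₃ * T₃ + a₄ * T₄)) / W -
      1 / W * ((a₁ * T₁ + a₂ * T₂ + a₃ * T₃ + a₄ * T₄) - (a₁ * T₁ + a₂ * T₂ + a₃ * T₃ + a₄ * T₄)) +
      (∑ σ : Fin 2, (fun σ => (a₁ / κ₁ * μ₁ σ + a₂ / κ₂ * μ₂ σ + a₃ / κ₃ * μ₃ σ + a₄ / κ₄ * μ₄ σ) / W) σ) * (n / 2 - 7 / 16) =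
      S / W := by
    simp only [Fin.sum_univ_two]
    rw [hSdef, hg₁def, hg₂def, hg₃def, hg₄def]
    have e₁ : a₁ / κ₁ * (κ₁ * (u₁ - T₁)) = a₁ * (u₁ - T₁) := by field_simp
    have e₂ : a₂ / κ₂ * (κ₂ * (u₂ - T₂)) = a₂ * (u₂ - T₂) := by field_simp
    have e₃ : a₃ / κ₃ * (κ₃ * (u₃ - T₃)) = a₃ * (u₃ - T₃) := by field_simp
    have e₄ : a₄ / κ₄ * (κ₄ * (u₄ - T₄)) = a₄ * (u₄ - T₄) := by field_simp
    have f₁ : a₁ / κ₁ * (c₁ + κ₁ * u₁) = a₁ / κ₁ * c₁ + a₁ * u₁ := by field_simp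
    have f₂ : a₂ / κ₂ * (c₂ + κ₂ * u₂) = a₂ / κ₂ * c₂ + a₂ * u₂ := by field_simp
    have f₃ : a₃ / κ₃ * (c₃ + κ₃ * u₃) = a₃ / κ₃ * c₃ + a₃ * u₃ := by field_simp
    have f₄ : a₄ / κ₄ * (c₄ + κ₄ * u₄) = a₄ / κ₄ * c₄ + a₄ * u₄ := by field_simp
    have hWne : W ≠ 0 := ne_of_gt hW
    rw [f₁, f₂, f₃, f₄]
    have ex : ∀ x : ℝ, a₁ / κ₁ * (c₁ + κ₁ * (u₁ - T₁) + x) = a₁ / κ₁ * c₁ + a₁ * (u₁ - T₁) + a₁ / κ₁ * x := fun x => by rw [mul_add, mul_add, e₁]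
    have ey : ∀ x : ℝ, a₂ / κ₂ * (c₂ + κ₂ * (u₂ - T₂) + x) = a₂ / κ₂ * c₂ + a₂ * (u₂ - T₂) + a₂ / κ₂ * x := fun x => by rw [mul_add, mul_add, e₂]
    have ez : ∀ x : ℝ, a₃ / κ₃ * (c₃ + κ₃ * (u₃ - T₃) + x) = a₃ / κ₃ * c₃ + a₃ * (u₃ - T₃) + a₃ / κ₃ * x := fun x => by rw [mul_add, mul_add, e₃]
    have ew : ∀ x : ℝ, a₄ / κ₄ * (c₄ + κ₄ * (u₄ - T₄) + x) = a₄ / κ₄ * c₄ + a₄ * (u₄ - T₄) + a₄ / κ₄ * x := fun x => by rw [mul_add, mul_add, e₄]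
    rw [ex, ey, ez, ew]
    field_simp
    ring
  rw [key]
  have t₁ := mul_le_mul_of_nonneg_left hg₁.1 hw₁
  have t₂ := mul_le_mul_of_nonneg_left hg₂.1 hw₂
  have t₃ := mul_le_mul_of_nonneg_left hg₃.1 hw₃
  have t₄ := mul_le_mul_of_nonneg_left hg₄.1 hw₄
  have t₁' := mul_le_mul_of_nonneg_left hg₁.2 hw₁
  have t₂' := mul_le_mul_of_nonneg_left hg₂.2 hw₂
  have t₃' := mul_le_mul_of_nonneg_left hg₃.2 hw₃
  have t₄' := mul_le_mul_of_nonneg_left hg₄.2 hw₄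
  have eW : m * W = a₁ / κ₁ * m + a₂ / κ₂ * m + a₃ / κ₃ * m + a₄ / κ₄ * m := by rw [hWdef]; ring
  have eW' : -m * W = a₁ / κ₁ * (-m) + a₂ / κ₂ * (-m) + a₃ / κ₃ * (-m) + a₄ / κ₄ * (-m) := by rw [hWdef]; ring
  have hSlo : -m * W ≤ S := by rw [eW', hSdef]; linarith
  have hShi : S ≤ m * W := by rw [eW, hSdef]; linarith
  have q1 : -m ≤ S / W := by rw [le_div_iff₀ hW]; exact hSlo
  have q2 : S / W ≤ m := by rw [div_le_iff₀ hW]; exact hShi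
  exact (sq_le_sq' q1 q2).trans hc'

/-! ### §3 BOX1-OP1E-CORNERS on the whole 3-D box: caps at density `n` by name, and the word -/

/-- The transported node constant in the dictionary `c = −M̃/s`, `κ = κ̃/s`, `μ_σ = λ_σ/s` (`s = √2`): bounds on
`−M̃ + κ̃(u − T) + (λ₀ + λ₁)d` pass to `−M̃/s + (κ̃/s)(u − T) + (λ₀/s + λ₁/s)d`. [cite: KomaTasaki1994, Theorem 5] -/
theorem transported_const_mem {M k u T l₀ l₁ d B s : ℝ} (hs : 0 < s)
    (hlo : -B ≤ -M + k * (u - T) + (l₀ + l₁) * d) (hhi : -M + k * (u - T) + (l₀ + l₁) * d ≤ B) :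
    -(B / s) ≤ -M / s + k / s * (u - T) + (l₀ / s + l₁ / s) * d ∧ -M / s + k / s * (u - T) + (l₀ / s + l₁ / s) * d ≤ B / s := by
  have e : -M / s + k / s * (u - T) + (l₀ / s + l₁ / s) * d = (-M + k * (u - T) + (l₀ + l₁) * d) / s := by ring
  rw [e, ← neg_div]
  exact ⟨div_le_div_of_nonneg_right hlo hs.le, div_le_div_of_nonneg_right hhi hs.le⟩

/-- **«BOX1-OP1E-CORNERS» — THE 3-D BOX WORD (zero extra solves).** For EVERY `(U, t′, n) ∈ [15/2, 17/2] × [−3/10, −1/5] × [173/200, 177/200]`: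
`ObsPairLROCeilingAt t′ U n 7210837/10000000` (= ⌈B²/2⌉₇, `B = 12009026781/10000000000 ≥` every transported corner constant; the worst point is the NW corner at
`n = 173/200`). Conditional ONLY on the four corner claim nodes, #445, #257 Dlo/Dup, #472 `cert_r472_pb2_tl_upper_n1_U8`, #488
`cert_r488_hubSQ_hanK7R6_U6_r5_e4_so4blk` (the `n = 1` cap `R₁max` of `BoxWordCuprate3d.boxCuprate3d_cap1_of`) and the FS-1 `−HOP2` literal of the n = 7/8
pyramid. Caps at density `n`: vacuum chord of the pyramid below 7/8, density chord pyramid → `R₁max` above 7/8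
(`energyDensityTT'_le_density_chord_of_mem_Icc`). Transported corner words (M̃′²/2) at `n = 173/200 ∣ 7/8 ∣ 177/200`: SW 0.7123071 ∣ 0.6749550 ∣ 0.6667320 · NW 0.7210836 ∣ 0.6830181 ∣ 0.6717108 · SE 0.6786615 ∣ 0.6404189 ∣ 0.6248835 · NE 0.6889943 ∣ 0.6502353 ∣ 0.6317016.
Comparators: face 0.6830181 (`box1_op1e_corners_face`), CHORD 3-D edition 0.8802759 (`box1chord_box3d`). A ceiling; says nothing about presence.
[cite: KomaTasaki1994, Theorem 5] [cite: Israel1979, Thm. I.3.4] [cite: Ruelle1969, §3.3] -/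
theorem box1_op1e_corners_box3d (hSW : cert_obsOP1E_pairamp_TLB0gbD2_U15o2_tpm3o10_n7o8_box1SW_up) (hNW : cert_obsOP1E_pairamp_TLB0gbD2_U15o2_tpm1o5_n7o8_box1NW_up) (hSE : cert_obsOP1E_pairamp_TLB0gbD2_U17o2_tpm3o10_n7o8_box1SE_up) (hNE : cert_obsOP1E_pairamp_TLB0gbD2_U17o2_tpm1o5_n7o8_box1NE_up)
    (h445 : cert_dbt329pair_allk) (h257lo : cert_r257_lro_M3U8tpm1o4_w2_b4_kry1_kry2c3_hop2_Dlo)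
    (h257up : cert_r257_lro_M3U8tpm1o4_w2_b4_kry1_kry2c3_hop2_Dup)
    (htau : ∀ (ω : InfVolFermionState 2) (Ls : ℕ → ℕ) (ψ : ∀ L, Fock (Orb (FermionTorus 2 L))),
      Tendsto Ls atTop atTop →
      (∀ j, IsGroundStateInSector (hubbardTorusTT' (Ls j) 1 (-1/4) 8) (rectN (7/8) (Ls j)) 0 (ψ (Ls j))) →
      (∀ j, star (ψ (Ls j)) ⬝ᵥ ψ (Ls j) = 1) → ω.IsTorusLimitOf ψ Ls →
      (-6023622597/10000000000 : ℝ) ≤ ω.meanEnergy (hubbardTTPrimeFermionInteraction 0 1 0) 1 ∧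
        ω.meanEnergy (hubbardTTPrimeFermionInteraction 0 1 0) 1 ≤ (11460582111/10000000000 : ℝ))
    (h472 : cert_r472_pb2_tl_upper_n1_U8) (h488 : cert_r488_hubSQ_hanK7R6_U6_r5_e4_so4blk)
    {tp U n : ℝ} (htp : -3/10 ≤ tp ∧ tp ≤ -1/5) (hU : 15/2 ≤ U ∧ U ≤ 17/2) (hn : 173/200 ≤ n ∧ n ≤ 177/200) :
    ObsPairLROCeilingAt tp U n (7210837/10000000) := by
  have h2 : (0 : ℝ) < Real.sqrt 2 := Real.sqrt_pos.mpr (by norm_num)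
  have hs : Real.sqrt 2 ^ 2 = 2 := Real.sq_sqrt (by norm_num)
  obtain ⟨ht1, ht2⟩ := htp
  obtain ⟨hU1, hU2⟩ := hU
  obtain ⟨hn1, hn2⟩ := hn
  have hU0 : (0:ℝ) ≤ U := by linarith
  have hn0 : (0:ℝ) < n := by linarith
  have hn2' : n < (2:ℝ) := by linarith
  have hc' : ((((12009026781/10000000000 : ℚ)) : ℝ) / Real.sqrt 2) ^ 2 ≤ (((7210837/10000000 : ℚ)) : ℝ) := by rw [div_pow, hs]; norm_num
  have huSW : box1CapPyramid (-3/10) (15/2) ≤ (((-311912228217272379409095102365119/472236648286964521369600000000000 : ℚ)) : ℝ) := by norm_num [box1CapPyramid]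
  have huNW : box1CapPyramid (-1/5) (15/2) ≤ (((-299074570528455961625890587213247/472236648286964521369600000000000 : ℚ)) : ℝ) := by norm_num [box1CapPyramid]
  have huSE : box1CapPyramid (-3/10) (17/2) ≤ (((-287720670703802555638922250802619/472236648286964521369600000000000 : ℚ)) : ℝ) := by norm_num [box1CapPyramid]
  have huNE : box1CapPyramid (-1/5) (17/2) ≤ (((-274883013014986137855717735650747/472236648286964521369600000000000 : ℚ)) : ℝ) := by norm_num [box1CapPyramid]
  -- the cap AT n = 7/8 at θ: the tensor interpolant of the corner references majorises the pyramid, which majorises e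
  have hpyr : energyDensityTT' 1 tp U (7 / 8) ≤ box1CapPyramid tp U := by
    have := BoxWordCuprate3d.boxCuprate3d_plane_of h445 h257lo h257up htau tp hU0
    simpa only [box1CapPyramid] using this
  have hbil := box1CapPyramid_le_bilinear ⟨ht1, ht2⟩ ⟨hU1, hU2⟩
  have hw1 : 0 ≤ (10 * ((17/2 - U) * (-1/5 - tp))) := mul_nonneg (by norm_num) (mul_nonneg (by linarith) (by linarith))
  have hw2 : 0 ≤ (10 * ((17/2 - U) * (tp + 3/10))) := mul_nonneg (by norm_num) (mul_nonneg (by linarith) (by linarith))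
  have hw3 : 0 ≤ (10 * ((U - 15/2) * (-1/5 - tp))) := mul_nonneg (by norm_num) (mul_nonneg (by linarith) (by linarith))
  have hw4 : 0 ≤ (10 * ((U - 15/2) * (tp + 3/10))) := mul_nonneg (by norm_num) (mul_nonneg (by linarith) (by linarith))
  have hsum1 : (10 * ((17/2 - U) * (-1/5 - tp))) + (10 * ((17/2 - U) * (tp + 3/10))) + (10 * ((U - 15/2) * (-1/5 - tp))) + (10 * ((U - 15/2) * (tp + 3/10))) = 1 := by ring
  have hu78 : energyDensityTT' 1 tp U (7 / 8) ≤ (10 * ((17/2 - U) * (-1/5 - tp))) * (((-311912228217272379409095102365119/472236648286964521369600000000000 : ℚ)) : ℝ) + (10 * ((17/2 - U) * (tp + 3/10))) * (((-299074570528455961625890587213247/472236648286964521369600000000000 : ℚ)) : ℝ) + (10 * ((U - 15/2) * (-1/5 - tp))) * (((-287720670703802555638922250802619/472236648286964521369600000000000 : ℚ)) : ℝ) + (10 * ((U - 15/2) * (tp + 3/10))) * (((-274883013014986137855717735650747/472236648286964521369600000000000 : ℚ)) : ℝ) := by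
    have m₁ := mul_le_mul_of_nonneg_left huSW hw1
    have m₂ := mul_le_mul_of_nonneg_left huNW hw2
    have m₃ := mul_le_mul_of_nonneg_left huSE hw3
    have m₄ := mul_le_mul_of_nonneg_left huNE hw4
    linarith [hpyr, hbil, m₁, m₂, m₃, m₄]
  rcases le_total n (7/8) with hle | hge
  · -- n ≤ 7/8: VACUUM CHORD of the interpolated cap (e convex in n, e(0) ≤ 0): T_v = (8n/7)·u_v
    have h0 : energyDensityTT' 1 tp U 0 ≤ 0 := energyDensityTT'_density_zero_le 1 tp hU0
    have hmem : n ∈ Set.Icc (0 : ℝ) (7/8) := Set.mem_Icc.mpr ⟨hn0.le, hle⟩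
    have hch := energyDensityTT'_le_density_chord_of_mem_Icc 1 tp hU0 (m₁ := 0) (m₂ := 7/8) (u₁ := 0) le_rfl (by norm_num) (by norm_num)
      h0 hu78 hmem
    have hT : energyDensityTT' 1 tp U n ≤ (10 * ((17/2 - U) * (-1/5 - tp))) * (8 * n / 7 * (((-311912228217272379409095102365119/472236648286964521369600000000000 : ℚ)) : ℝ)) + (10 * ((17/2 - U) * (tp + 3/10))) * (8 * n / 7 * (((-299074570528455961625890587213247/472236648286964521369600000000000 : ℚ)) : ℝ)) +
        (10 * ((U - 15/2) * (-1/5 - tp))) * (8 * n / 7 * (((-287720670703802555638922250802619/472236648286964521369600000000000 : ℚ)) : ℝ)) + (10 * ((U - 15/2) * (tp + 3/10))) * (8 * n / 7 * (((-274883013014986137855717735650747/472236648286964521369600000000000 : ℚ)) : ℝ)) := by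
      refine hch.trans (le_of_eq ?_)
      field_simp
      ring
    refine box1Box3d_pairLROCeilingAt_of_cornerRows (Kκ := (((4711282196943/4398046511104 : ℚ)) : ℝ) / Real.sqrt 2) (m := (((12009026781/10000000000 : ℚ)) : ℝ) / Real.sqrt 2)
      (OP1ERowAtU_box1SW hSW) (OP1ERowAtU_box1NW hNW) (OP1ERowAtU_box1SE hSE) (OP1ERowAtU_box1NE hNE)
      (by positivity) (by positivity) (by positivity) (by positivity)
      (div_le_div_of_nonneg_right (by norm_num) h2.le)
      (div_le_div_of_nonneg_right (by norm_num) h2.le)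
      (div_le_div_of_nonneg_right (by norm_num) h2.le)
      (div_le_div_of_nonneg_right (by norm_num) h2.le)
      ⟨ht1, ht2⟩ ⟨hU1, hU2⟩ hn0 hn2' hT ?_ ?_ ?_ ?_ hc'
    · simp only [Matrix.cons_val_zero, Matrix.cons_val_one]
      refine transported_const_mem h2 ?_ ?_
      · push_cast; linarith only [hn1, hle]
      · push_cast; linarith only [hn1, hle]
    · simp only [Matrix.cons_val_zero, Matrix.cons_val_one]
      refine transported_const_mem h2 ?_ ?_
      · push_cast; linarith only [hn1, hle]
      · push_cast; linarith only [hn1, hle]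
    · simp only [Matrix.cons_val_zero, Matrix.cons_val_one]
      refine transported_const_mem h2 ?_ ?_
      · push_cast; linarith only [hn1, hle]
      · push_cast; linarith only [hn1, hle]
    · simp only [Matrix.cons_val_zero, Matrix.cons_val_one]
      refine transported_const_mem h2 ?_ ?_
      · push_cast; linarith only [hn1, hle]
      · push_cast; linarith only [hn1, hle]
  · -- n ≥ 7/8: DENSITY CHORD between the interpolated cap at 7/8 and the n = 1 cap R₁max (#472, #488): T_v = 8((1−n)u_v + (n−7/8)R₁max)
    have hn1' : n ≤ (1 : ℝ) := by linarith only [hn2]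
    have hu1 : energyDensityTT' 1 tp U 1 ≤ (-558838917964834858618669/1208925819614629174706176 : ℝ) :=
      BoxWordCuprate3d.boxCuprate3d_cap1_of h472 h488 tp hU0 hU2
    have hmem : n ∈ Set.Icc (7/8 : ℝ) 1 := Set.mem_Icc.mpr ⟨hge, hn1'⟩
    have hch := energyDensityTT'_le_density_chord_of_mem_Icc 1 tp hU0 (m₁ := 7/8) (m₂ := 1) (by norm_num) (by norm_num) (by norm_num)
      hu78 hu1 hmem
    have hT : energyDensityTT' 1 tp U n ≤ (10 * ((17/2 - U) * (-1/5 - tp))) * (8 * ((1 - n) * (((-311912228217272379409095102365119/472236648286964521369600000000000 : ℚ)) : ℝ) + (n - 7/8) * (-558838917964834858618669/1208925819614629174706176 : ℝ))) + (10 * ((17/2 - U) * (tp + 3/10))) * (8 * ((1 - n) * (((-299074570528455961625890587213247/472236648286964521369600000000000 : ℚ)) : ℝ) + (n - 7/8) * (-558838917964834858618669/1208925819614629174706176 : ℝ))) +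
        (10 * ((U - 15/2) * (-1/5 - tp))) * (8 * ((1 - n) * (((-287720670703802555638922250802619/472236648286964521369600000000000 : ℚ)) : ℝ) + (n - 7/8) * (-558838917964834858618669/1208925819614629174706176 : ℝ))) + (10 * ((U - 15/2) * (tp + 3/10))) * (8 * ((1 - n) * (((-274883013014986137855717735650747/472236648286964521369600000000000 : ℚ)) : ℝ) + (n - 7/8) * (-558838917964834858618669/1208925819614629174706176 : ℝ))) := by
      refine hch.trans (le_of_eq ?_)
      rw [div_eq_iff (by norm_num : (1:ℝ) - 7/8 ≠ 0)]
      linear_combination (-(n - 7/8) * (-558838917964834858618669/1208925819614629174706176 : ℝ) * (1 - 7/8) * 8) * hsum1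
    refine box1Box3d_pairLROCeilingAt_of_cornerRows (Kκ := (((4711282196943/4398046511104 : ℚ)) : ℝ) / Real.sqrt 2) (m := (((12009026781/10000000000 : ℚ)) : ℝ) / Real.sqrt 2)
      (OP1ERowAtU_box1SW hSW) (OP1ERowAtU_box1NW hNW) (OP1ERowAtU_box1SE hSE) (OP1ERowAtU_box1NE hNE)
      (by positivity) (by positivity) (by positivity) (by positivity)
      (div_le_div_of_nonneg_right (by norm_num) h2.le)
      (div_le_div_of_nonneg_right (by norm_num) h2.le)
      (div_le_div_of_nonneg_right (by norm_num) h2.le)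
      (div_le_div_of_nonneg_right (by norm_num) h2.le)
      ⟨ht1, ht2⟩ ⟨hU1, hU2⟩ hn0 hn2' hT ?_ ?_ ?_ ?_ hc'
    · simp only [Matrix.cons_val_zero, Matrix.cons_val_one]
      refine transported_const_mem h2 ?_ ?_
      · push_cast; linarith only [hn2, hge]
      · push_cast; linarith only [hn2, hge]
    · simp only [Matrix.cons_val_zero, Matrix.cons_val_one]
      refine transported_const_mem h2 ?_ ?_
      · push_cast; linarith only [hn2, hge]
      · push_cast; linarith only [hn2, hge]
    · simp only [Matrix.cons_val_zero, Matrix.cons_val_one]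
      refine transported_const_mem h2 ?_ ?_
      · push_cast; linarith only [hn2, hge]
      · push_cast; linarith only [hn2, hge]
    · simp only [Matrix.cons_val_zero, Matrix.cons_val_one]
      refine transported_const_mem h2 ?_ ?_
      · push_cast; linarith only [hn2, hge]
      · push_cast; linarith only [hn2, hge]

end Summit.Ventures.CertifiedManyBodySolver.Certificates

end
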